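import Mathlib
import Summits.Langlands.Langlands.Theses.PhantomRMYoshida
import Summits.Langlands.Langlands.Theorems.PhantomRMYoshidaResiduallyYoshidaLiftingResidualSplitting
import Summits.Langlands.Langlands.Theorems.PhantomRMYoshidaResiduallyYoshidaLiftingDefs
import Summits.Langlands.Langlands.Theorems.PhantomRMYoshidaResiduallyYoshidaLiftingEndoscopicReduction
import Summits.Langlands.Langlands.Theorems.PhantomRMYoshidaResiduallyYoshidaLiftingTraceLimitRemoval

/-!
# Line `endoscopic-crossing-euler` — skeleton for crux `PhantomRMYoshida.ResiduallyYoshidaLifting`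
# (stmt-Langlands-13639, route-Langlands-PhantomRMYoshida) — rev 9 (re-seated lead a1-0, 2026-08-16; = rev 8 of c1-0,
# stubs byte-identical, re-registered by this seat; see PICKED.md of a1-0 for the expected outcome)

**Idea** (crux-idea card `endoscopic-crossing-euler`; see rev ≤ 4 in the crux directory for the full text).
In the Λ-adic ordinary deformation / Hida picture at the residually Yoshida point `ρ̄ = σ̄ ⊕ σ̄'`, run a
Wiles–Lenstra numerical criterion at a height-one endoscopic–stable CROSSING prime `P` of the Yoshida divisor
(Beilinson–Flach Euler system + Hsieh–Liu `θ ∣ 𝒞`), get `R_P ≅ 𝕋_P`, propagate à la Skinner–Wiles, so that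
`tr ρ` is a `p`-adic limit of automorphic-or-endoscopic ordinary regular-weight traces of bounded tame level,
and finish by weight-(2,2) classicality + `GSp₄ → GL₄` transfer.

**rev 6 = the line reduced to its proved-minimal open core.**  History: rev 2 (planner) had four stubs;
the second lead (b-0) landed Stub 1 (`stub_numericalCriterion`, dSRS Criterion I) and Stub 2
(`stub_residualYoshidaSplitting`, via four sub-stubs 2a–2d, all landed:
`Theorems/PhantomRMYoshidaResiduallyYoshidaLifting{ResidualCharpoly,ResidualTriangular,BlockSumConj,SplitFrame,
ResidualSplitting}.lean`), reshaped Stub 4 (residual data restored, `≤` route target) and proved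
(`Cruxes/…/LeadStub3Inert.lean`) that the registered lever `stub_yoshidaCrossingRT` — a 40-binder ∃-package
`(C1)–(C11)` — is, for abstract rings, EQUIVALENT modulo the true Stub 1 to the bare pro-automorphy statement
`∃ S, ProAut S ρ` (its Wiles–Lenstra conjuncts are satisfied by a junk model; its deformation-theoretic conjuncts
are discarded by the glue, Disproof T7).  rev 6 therefore REPLACES the lever by that core:

* `stub_proAutomorphy` (NEW registered stub, replaces `stub_yoshidaCrossingRT`; HARDEST, open in print) —
  under the crux hypotheses and given `ℤ̄_p`-frames of `ρ₀`, `ρ` with split reduction (landed Stub 2), there is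
  a finite set `S` of places such that for every `n`, `tr ρ` is uniformly `p⁻ⁿ`-close on `Γ_ℚ` to the trace of
  a representation `r'` which is automorphic (cuspidal L-algebraic on `GL₄`, Satake = Frobenius a.e.) OR
  endoscopic (trace = sum of two 2-dimensional traces), `GSp`-valued, Greenberg-ordinary of some REGULAR shape
  at `p`, unramified outside `S ∪ {p}`.  (= Λ-adic `R^{ord}_𝔪 = 𝕋^{ord}_𝔪` at the Yoshida `𝔪` with the
  endoscopic components KEPT, read at the point of `ρ`, plus Zariski density of regular classical points —
  the route's layer L1 / CODIM.md engine E1′.  The line's crossing-prime mechanism is a candidate PROOF of it.)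
* rev 8: `stub_weightTwoClassicalityAut` (NEW registered open stub: AUTOMORPHIC approximants only) implies the old
  Stub 4 by the wave-1 worker's landed ENDO-REMOVAL theorem `stub_endoRemoval` (`…TraceLimitRemoval.lean` + packages
  `…TraceLimit{,Endo,Pseudo,Unique,Idempotent,Residual,Complete,IntegralModel}.lean`); the old
* `stub_weightTwoClassicality` (registered ≤ rev 7, now a THEOREM of this file) — weight-(2,2) classicality + transfer at the
  Yoshida `𝔪` in Galois form: an irreducible `Sh`-representation which is ordinarily pro-automorphic of tame
  level `S` in the above sense is automorphic.  `≤` route target `PhantomRMSector`.  Open in print.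

**Glue** (sorry-free, below): landed Stub 2 for `ρ₀` and `ρ` ⟶ `stub_proAutomorphy` ⟶
`stub_weightTwoClassicality`.  `ρ.IsIrreducible` is consumed by both stubs; `Aut ρ₀`, `Sh ρ₀` only by
`stub_proAutomorphy` (non-emptiness of the STABLE part of the ordinary Hecke algebra at `𝔪`; the endoscopic
anchor is free).  The companion Theorems file `PhantomRMYoshidaResiduallyYoshidaLiftingEndoscopicReduction.lean`
(this lead) names the two statements, proves this composition in the tree, and compares them with line
`yoshida-divisor-selmer-count`'s landed residue (`EveryShIsLimit ⟹ ProAutOfSh ⟹ stub_proAutomorphy`;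
`stub_weightTwoClassicality ⟹ OrdinaryLimitClassicality`; target ⟹ both classicality statements).

**Disproof used** (Cruxes/…/Disproof.lean, cdisprove gen ≤ 5, 2026-08-16T05:14Z): T7 (glue discards C1–C4),
T8 (a line's excess over the crux is its pro-automorphy layer), §8 targets-b (0 stub-false / 0 stub-misstated on
this line; 2a–2d TRUE and landed; Stub 3 "promote-stub grade"; Stub 4 v2 ≤ target), `iff_withoutOdd`
(oddness is decoration — kept verbatim in Stub 4 because registered), `not_withoutIrreducibleρ_of_witness`
(irreducibility of `ρ` load-bearing — it is a hypothesis of both stubs).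
-/

open Literature.NumberTheory.GaloisRepresentations

namespace Summit.Langlands.Langlands.Cruxes.ResiduallyYoshidaLifting.EndoscopicCrossingEuler

set_option linter.dupNamespace false

/-! ## Stubs 1, 2 — LANDED (see the module docstring); Stub 2 is imported:
`stub_residualYoshidaSplitting` from `Theorems/PhantomRMYoshidaResiduallyYoshidaLiftingResidualSplitting.lean`. -/

/-! ## Stub 3′ — ordinary pro-automorphy at the Yoshida maximal ideal (the open core of the lever) -/

/-- **Stub 3′ `stub_proAutomorphy` (replaces the registered lever `stub_yoshidaCrossingRT`; HARDEST, open).**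
Fix the crux data (`p` odd, `k`, `red`, the residual pair `σ̄, σ̄'` irreducible, non-conjugate,
`det = ε̄⁻¹`, `hcpt`, `ι`), an irreducible automorphic `ρ₀` and an irreducible `ρ`, both of shape `Sh`
(symplectic-`ε⁻¹`, Greenberg-ordinary `(0,0,1,1)`, `p`-distinguished, residually `σ̄ ⊕ σ̄'` through `red`), and
`ℤ̄_p`-frames of `ρ₀`, `ρ` with block-diagonal reduction `h(σ̄ ⊕ σ̄')h⁻¹` (supplied by the landed Stub 2).  Then
there is a finite set `S` of finite places such that for every `n : ℕ` some continuous
`r' : Γ_ℚ → GL₄(ℚ̄_p)` satisfies: `r'` is automorphic (`Aut`) or endoscopic (`Endo`: `tr r' = tr r₁ + tr r₂`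
for 2-dimensional `r₁, r₂`); `r'` is Greenberg-ordinary at `p` of some strictly increasing shape, unramified
outside `S ∪ {p}`, and symplectic for some multiplier (`OrdLevel S r'`); and `‖tr r'(g) − tr ρ(g)‖ ≤ p⁻ⁿ` for
all `g ∈ Γ_ℚ`.  INTENDED PROOF (the line): big ordinary `R ↠ 𝕋` at the Yoshida `𝔪` of tame level `S`
(`ρ̄` is `GSp₄`-Schur, CODIM.md), `R_P ≅ 𝕋_P` at an endoscopic–stable crossing prime by Criterion I with
the Rankin–Selberg main-conjecture inequality (Beilinson–Flach, Kings–Loeffler–Zerbes; `θ ∣ 𝒞_{Yos}`,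
Hsieh–Liu, announced in Hsieh–Palvannan 2025 §1.5, unpublished), Skinner–Wiles propagation to the component
of `x_ρ`, Hida density/control on `𝕋` (Tilouine–Urban, Pilloni).  Equivalently (CODIM.md E1′): `R^{ord}_𝔪 =
𝕋^{ord}_𝔪` with endoscopic components kept, via Lagrangian-isotypic Taylor–Wiles primes.  Neither is in
print in any weight for a residually Yoshida `𝔪`.  Size: open (XL⁺).
[cite: HsiehPalvannan2025, §1.5; KingsLoefflerZerbes2015, Thm 11.6.4; SkinnerWiles1999, §3;
BellaicheChenevier2009, Thm 1.5.5; TilouineUrban1999; Pilloni2012] -/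
theorem stub_proAutomorphy :
    ∀ (p : ℕ) [Fact p.Prime], p ≠ 2 → ∀ (k : Type) [Field k] [CharP k p] [IsAlgClosed k]
      [TopologicalSpace k] [DiscreteTopology k] (red : Valued.integer (PadicAlgCl p) →+* k)
      (σ σ' : Literature.NumberTheory.GaloisRepresentations.FramedGaloisRep ℚ k 2)
      (hcpt : Literature.NumberTheory.Automorphic.isCompact_glFiniteIntegralLevel 4 ℚ)
      (ι : PadicAlgCl p ≃+* ℂ)
      (ρ₀ ρ : Literature.NumberTheory.GaloisRepresentations.FramedGaloisRep ℚ (PadicAlgCl p) 4),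
      let Endo := fun r : Literature.NumberTheory.GaloisRepresentations.FramedGaloisRep ℚ (PadicAlgCl p) 4 =>
        (∃ r₁ r₂ : Literature.NumberTheory.GaloisRepresentations.FramedGaloisRep ℚ (PadicAlgCl p) 2,
          ∀ g, (r g).val.trace = (r₁ g).val.trace + (r₂ g).val.trace);
      let OrdLevel := fun (S : Finset (IsDedekindDomain.HeightOneSpectrum (NumberField.RingOfIntegers ℚ)))
          (r : Literature.NumberTheory.GaloisRepresentations.FramedGaloisRep ℚ (PadicAlgCl p) 4) =>
        ((∃ a : Fin 4 → ℕ, StrictMono a ∧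
            ∀ v : IsDedekindDomain.HeightOneSpectrum (NumberField.RingOfIntegers ℚ),
              ((p : ℕ) : NumberField.RingOfIntegers ℚ) ∈ v.asIdeal → r.IsGreenbergOrdinaryOfShapeAt v a) ∧
          (∀ v : IsDedekindDomain.HeightOneSpectrum (NumberField.RingOfIntegers ℚ),
            ((p : ℕ) : NumberField.RingOfIntegers ℚ) ∉ v.asIdeal → v ∉ S → r.IsUnramifiedAt v) ∧
          (∃ ν : Field.absoluteGaloisGroup ℚ → PadicAlgCl p, r.IsSymplecticWithMultiplierFun ν));
      let SplitFrame := fun r : Literature.NumberTheory.GaloisRepresentations.FramedGaloisRep ℚ (PadicAlgCl p) 4 =>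
        (∃ (P : GL (Fin 4) (PadicAlgCl p))
          (rint : Field.absoluteGaloisGroup ℚ →* GL (Fin 4) (Valued.integer (PadicAlgCl p)))
          (h : GL (Fin 4) k),
          (∀ g, Matrix.GeneralLinearGroup.map (Valued.integer (PadicAlgCl p)).subtype (rint g) =
            P⁻¹ * r g * P) ∧
          (∀ g, (Matrix.GeneralLinearGroup.map red (rint g)).val =
            h.val * Matrix.reindex finSumFinEquiv finSumFinEquiv
              (Matrix.fromBlocks (σ g).val 0 0 (σ' g).val) * (h⁻¹).val));
      σ.toGaloisRep.IsIrreducible → σ'.toGaloisRep.IsIrreducible →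
      Summit.Langlands.Langlands.Cruxes.ResiduallyYoshidaLifting.YoshidaDivisorSelmerCount.DetC p k σ σ' →
      (¬ ∃ g : GL (Fin 2) k, ∀ x, g * σ x * g⁻¹ = σ' x) →
      ρ₀.toGaloisRep.IsIrreducible →
      Summit.Langlands.Langlands.Cruxes.ResiduallyYoshidaLifting.YoshidaDivisorSelmerCount.Sh p k red σ σ' ρ₀ →
      Summit.Langlands.Langlands.Cruxes.ResiduallyYoshidaLifting.YoshidaDivisorSelmerCount.Aut p hcpt ι ρ₀ →
      ρ.toGaloisRep.IsIrreducible →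
      Summit.Langlands.Langlands.Cruxes.ResiduallyYoshidaLifting.YoshidaDivisorSelmerCount.Sh p k red σ σ' ρ →
      SplitFrame ρ₀ → SplitFrame ρ →
      ∃ S : Finset (IsDedekindDomain.HeightOneSpectrum (NumberField.RingOfIntegers ℚ)),
        ∀ n : ℕ, ∃ r' : Literature.NumberTheory.GaloisRepresentations.FramedGaloisRep ℚ (PadicAlgCl p) 4,
          (Summit.Langlands.Langlands.Cruxes.ResiduallyYoshidaLifting.YoshidaDivisorSelmerCount.Aut p hcpt ι r' ∨ Endo r') ∧
            OrdLevel S r' ∧ ∀ g, ‖(r' g).val.trace - (ρ g).val.trace‖ ≤ (p : ℝ) ^ (-(n : ℤ)) := by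
  sorry

/-! ## Stub 4′ — weight-(2,2) classicality at an endoscopic maximal ideal, AUTOMORPHIC approximants -/

/-- **Stub 4′ `stub_weightTwoClassicalityAut` (rev 8; replaces the registered Stub 4 as the OPEN statement, which it
implies by the landed ENDO-REMOVAL theorem `stub_endoRemoval`, wave-1 stub-worker, `…TraceLimitRemoval.lean`).**
Same binders and residual hypotheses as Stub 4; the limit hypothesis now has AUTOMORPHIC approximants only: let
`ρ : Γ_ℚ → GL₄(ℚ̄_p)` be irreducible, symplectic-`ε⁻¹`, Greenberg-ordinary `(0,0,1,1)` and `p`-distinguished,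
residually `σ̄ ⊕ σ̄'` (a.e. factorisation), and suppose that for every `n` some AUTOMORPHIC `r'` (cuspidal L-algebraic
`π'` on `GL₄(𝔸_ℚ)`, Satake = Frobenius a.e.), `GSp`-valued, Greenberg-ordinary of some regular shape at `p` and
unramified outside `S ∪ {p}`, has `‖tr r'(g) − tr ρ(g)‖ ≤ p⁻ⁿ` on `Γ_ℚ`.  Then `ρ` is automorphic.  (= classicality +
`GSp₄ → GL₄` transfer of the weight-(2,2) ordinary `p`-distinguished eigensystem at the Yoshida `𝔪` carried by the
limit point of `ρ` on the big ordinary cuspidal Hecke algebra of tame level `S`.)  `≤` route target.  In print only for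
residually irreducible image (BoxerEtAl2021 Thm 8.4.1, BCGP2025 §4.12, Pilloni2020); OPEN at an endoscopic `𝔪`.
Size: open (XL⁺). [cite: BoxerEtAl2021, §4–§7 and Thm 8.4.1; BoxerCalegariGeePilloni2025, §4.12; Pilloni2020;
GeeTaibi2019; Arthur2013] -/
theorem stub_weightTwoClassicalityAut :
    ∀ (p : ℕ) [Fact p.Prime], p ≠ 2 → ∀ (k : Type) [Field k] [CharP k p] [IsAlgClosed k]
      [TopologicalSpace k] [DiscreteTopology k] (red : Valued.integer (PadicAlgCl p) →+* k)
      (σ σ' : Literature.NumberTheory.GaloisRepresentations.FramedGaloisRep ℚ k 2)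
      (hcpt : Literature.NumberTheory.Automorphic.isCompact_glFiniteIntegralLevel 4 ℚ)
      (ι : PadicAlgCl p ≃+* ℂ)
      (S : Finset (IsDedekindDomain.HeightOneSpectrum (NumberField.RingOfIntegers ℚ)))
      (ρ : Literature.NumberTheory.GaloisRepresentations.FramedGaloisRep ℚ (PadicAlgCl p) 4),
      let εb : Field.absoluteGaloisGroup ℚ →* (ZMod p)ˣ := (modularCyclotomicCharacter (AlgebraicClosure ℚ)
          (HasEnoughRootsOfUnity.natCard_rootsOfUnity (AlgebraicClosure ℚ) p)).comp
          (MulSemiringAction.toRingAut (Field.absoluteGaloisGroup ℚ) (AlgebraicClosure ℚ))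
      let Aut := fun r : Literature.NumberTheory.GaloisRepresentations.FramedGaloisRep ℚ (PadicAlgCl p) 4 =>
        (∃ π : Literature.NumberTheory.Automorphic.CuspidalAutomorphicRepData 4 ℚ hcpt, π.1.IsLAlgebraic ∧
          ∀ᶠ v : IsDedekindDomain.HeightOneSpectrum (NumberField.RingOfIntegers ℚ) in Filter.cofinite,
            ∃ a : Multiset ℂ, π.1.HasSatakeParamAt v a ∧ r.IsUnramifiedAt v ∧
              r.HasFrobCharpolyAt v
                (Literature.NumberTheory.Automorphic.arithFrobPolyOfSatake ι v.residueCard 1 a))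
      let OrdLevel := fun (S : Finset (IsDedekindDomain.HeightOneSpectrum (NumberField.RingOfIntegers ℚ)))
          (r : Literature.NumberTheory.GaloisRepresentations.FramedGaloisRep ℚ (PadicAlgCl p) 4) =>
        ((∃ a : Fin 4 → ℕ, StrictMono a ∧
            ∀ v : IsDedekindDomain.HeightOneSpectrum (NumberField.RingOfIntegers ℚ),
              ((p : ℕ) : NumberField.RingOfIntegers ℚ) ∈ v.asIdeal → r.IsGreenbergOrdinaryOfShapeAt v a) ∧
          (∀ v : IsDedekindDomain.HeightOneSpectrum (NumberField.RingOfIntegers ℚ),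
            ((p : ℕ) : NumberField.RingOfIntegers ℚ) ∉ v.asIdeal → v ∉ S → r.IsUnramifiedAt v) ∧
          (∃ ν : Field.absoluteGaloisGroup ℚ → PadicAlgCl p, r.IsSymplecticWithMultiplierFun ν))
      σ.IsOdd → σ'.IsOdd → σ.toGaloisRep.IsIrreducible → σ'.toGaloisRep.IsIrreducible →
      (∀ g, Literature.NumberTheory.GaloisRepresentations.FramedRep.det σ g =
          (Units.map (ZMod.castHom (dvd_refl p) k).toMonoidHom (εb g))⁻¹ ∧
        Literature.NumberTheory.GaloisRepresentations.FramedRep.det σ' g =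
          Literature.NumberTheory.GaloisRepresentations.FramedRep.det σ g) →
      (¬ ∃ g : GL (Fin 2) k, ∀ x, g * σ x * g⁻¹ = σ' x) →
      ρ.toGaloisRep.IsIrreducible →
      ρ.IsSymplecticWithMultiplierFun (fun g => algebraMap ℚ_[p] (PadicAlgCl p)
        ((((Literature.NumberTheory.GaloisRepresentations.GaloisRep.cyclotomicCharacter ℚ p g)⁻¹ :
          ℤ_[p]ˣ) : ℤ_[p]) : ℚ_[p])) →
      (∀ v : IsDedekindDomain.HeightOneSpectrum (NumberField.RingOfIntegers ℚ),
        ((p : ℕ) : NumberField.RingOfIntegers ℚ) ∈ v.asIdeal →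
          ρ.IsGreenbergOrdinaryOfShapeAt v ![0, 0, 1, 1] ∧ ρ.IsResiduallyDistinguishedAt v ![0, 0, 1, 1]) →
      (∀ᶠ v : IsDedekindDomain.HeightOneSpectrum (NumberField.RingOfIntegers ℚ) in Filter.cofinite,
        ρ.IsUnramifiedAt v ∧ σ.IsUnramifiedAt v ∧ σ'.IsUnramifiedAt v ∧
        ∃ (P : Polynomial (Valued.integer (PadicAlgCl p))) (P₁ P₂ : Polynomial k),
          ρ.HasFrobCharpolyAt v (P.map (Valued.integer (PadicAlgCl p)).subtype) ∧
          σ.HasFrobCharpolyAt v P₁ ∧ σ'.HasFrobCharpolyAt v P₂ ∧ P.map red = P₁ * P₂) →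
      (∀ n : ℕ, ∃ r' : Literature.NumberTheory.GaloisRepresentations.FramedGaloisRep ℚ (PadicAlgCl p) 4,
        Aut r' ∧ OrdLevel S r' ∧
          ∀ g, ‖(r' g).val.trace - (ρ g).val.trace‖ ≤ (p : ℝ) ^ (-(n : ℤ))) →
      Aut ρ := by
  sorry

/-! ## Stub 4 (registered ≤ rev 7) is now a THEOREM: Stub 4′ + endo-removal -/

/-- **The registered Stub 4 `stub_weightTwoClassicality` (statement verbatim), DERIVED** from Stub 4′ and the landed
endo-removal theorem `stub_endoRemoval` (`…TraceLimitRemoval.lean`): an irreducible `ρ` on an admissible fibre with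
automorphic-or-endoscopic approximants to every precision has automorphic approximants to every precision. -/
theorem stub_weightTwoClassicality :
    ∀ (p : ℕ) [Fact p.Prime], p ≠ 2 → ∀ (k : Type) [Field k] [CharP k p] [IsAlgClosed k]
      [TopologicalSpace k] [DiscreteTopology k] (red : Valued.integer (PadicAlgCl p) →+* k)
      (σ σ' : Literature.NumberTheory.GaloisRepresentations.FramedGaloisRep ℚ k 2)
      (hcpt : Literature.NumberTheory.Automorphic.isCompact_glFiniteIntegralLevel 4 ℚ)
      (ι : PadicAlgCl p ≃+* ℂ)
      (S : Finset (IsDedekindDomain.HeightOneSpectrum (NumberField.RingOfIntegers ℚ)))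
      (ρ : Literature.NumberTheory.GaloisRepresentations.FramedGaloisRep ℚ (PadicAlgCl p) 4),
      let εb : Field.absoluteGaloisGroup ℚ →* (ZMod p)ˣ := (modularCyclotomicCharacter (AlgebraicClosure ℚ)
          (HasEnoughRootsOfUnity.natCard_rootsOfUnity (AlgebraicClosure ℚ) p)).comp
          (MulSemiringAction.toRingAut (Field.absoluteGaloisGroup ℚ) (AlgebraicClosure ℚ))
      let Aut := fun r : Literature.NumberTheory.GaloisRepresentations.FramedGaloisRep ℚ (PadicAlgCl p) 4 =>
        (∃ π : Literature.NumberTheory.Automorphic.CuspidalAutomorphicRepData 4 ℚ hcpt, π.1.IsLAlgebraic ∧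
          ∀ᶠ v : IsDedekindDomain.HeightOneSpectrum (NumberField.RingOfIntegers ℚ) in Filter.cofinite,
            ∃ a : Multiset ℂ, π.1.HasSatakeParamAt v a ∧ r.IsUnramifiedAt v ∧
              r.HasFrobCharpolyAt v
                (Literature.NumberTheory.Automorphic.arithFrobPolyOfSatake ι v.residueCard 1 a))
      let Endo := fun r : Literature.NumberTheory.GaloisRepresentations.FramedGaloisRep ℚ (PadicAlgCl p) 4 =>
        (∃ r₁ r₂ : Literature.NumberTheory.GaloisRepresentations.FramedGaloisRep ℚ (PadicAlgCl p) 2,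
          ∀ g, (r g).val.trace = (r₁ g).val.trace + (r₂ g).val.trace)
      let OrdLevel := fun (S : Finset (IsDedekindDomain.HeightOneSpectrum (NumberField.RingOfIntegers ℚ)))
          (r : Literature.NumberTheory.GaloisRepresentations.FramedGaloisRep ℚ (PadicAlgCl p) 4) =>
        ((∃ a : Fin 4 → ℕ, StrictMono a ∧
            ∀ v : IsDedekindDomain.HeightOneSpectrum (NumberField.RingOfIntegers ℚ),
              ((p : ℕ) : NumberField.RingOfIntegers ℚ) ∈ v.asIdeal → r.IsGreenbergOrdinaryOfShapeAt v a) ∧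
          (∀ v : IsDedekindDomain.HeightOneSpectrum (NumberField.RingOfIntegers ℚ),
            ((p : ℕ) : NumberField.RingOfIntegers ℚ) ∉ v.asIdeal → v ∉ S → r.IsUnramifiedAt v) ∧
          (∃ ν : Field.absoluteGaloisGroup ℚ → PadicAlgCl p, r.IsSymplecticWithMultiplierFun ν))
      σ.IsOdd → σ'.IsOdd → σ.toGaloisRep.IsIrreducible → σ'.toGaloisRep.IsIrreducible →
      (∀ g, Literature.NumberTheory.GaloisRepresentations.FramedRep.det σ g =
          (Units.map (ZMod.castHom (dvd_refl p) k).toMonoidHom (εb g))⁻¹ ∧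
        Literature.NumberTheory.GaloisRepresentations.FramedRep.det σ' g =
          Literature.NumberTheory.GaloisRepresentations.FramedRep.det σ g) →
      (¬ ∃ g : GL (Fin 2) k, ∀ x, g * σ x * g⁻¹ = σ' x) →
      ρ.toGaloisRep.IsIrreducible →
      ρ.IsSymplecticWithMultiplierFun (fun g => algebraMap ℚ_[p] (PadicAlgCl p)
        ((((Literature.NumberTheory.GaloisRepresentations.GaloisRep.cyclotomicCharacter ℚ p g)⁻¹ :
          ℤ_[p]ˣ) : ℤ_[p]) : ℚ_[p])) →
      (∀ v : IsDedekindDomain.HeightOneSpectrum (NumberField.RingOfIntegers ℚ),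
        ((p : ℕ) : NumberField.RingOfIntegers ℚ) ∈ v.asIdeal →
          ρ.IsGreenbergOrdinaryOfShapeAt v ![0, 0, 1, 1] ∧ ρ.IsResiduallyDistinguishedAt v ![0, 0, 1, 1]) →
      (∀ᶠ v : IsDedekindDomain.HeightOneSpectrum (NumberField.RingOfIntegers ℚ) in Filter.cofinite,
        ρ.IsUnramifiedAt v ∧ σ.IsUnramifiedAt v ∧ σ'.IsUnramifiedAt v ∧
        ∃ (P : Polynomial (Valued.integer (PadicAlgCl p))) (P₁ P₂ : Polynomial k),
          ρ.HasFrobCharpolyAt v (P.map (Valued.integer (PadicAlgCl p)).subtype) ∧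
          σ.HasFrobCharpolyAt v P₁ ∧ σ'.HasFrobCharpolyAt v P₂ ∧ P.map red = P₁ * P₂) →
      (∀ n : ℕ, ∃ r' : Literature.NumberTheory.GaloisRepresentations.FramedGaloisRep ℚ (PadicAlgCl p) 4,
        (Aut r' ∨ Endo r') ∧ OrdLevel S r' ∧
          ∀ g, ‖(r' g).val.trace - (ρ g).val.trace‖ ≤ (p : ℝ) ^ (-(n : ℤ))) →
      Aut ρ := by
  intro p _ hp k _ _ _ _ _ red σ σ' hcpt ι S ρ εb Aut Endo OrdLevel hodd hodd' hσ hσ' hdet hnc hirr hsymp hord hae hpro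
  exact stub_weightTwoClassicalityAut p hp k red σ σ' hcpt ι S ρ hodd hodd' hσ hσ' hdet hnc hirr hsymp hord hae
    (stub_endoRemoval p k red σ σ' Aut (OrdLevel S) ρ hσ hσ' hnc hirr hae hpro)

/-! ## Glue (sorry-free): the crux from the landed Stub 2 and the two open stubs -/

/-- The registered Stub 3′ IS the landed statement `StubProAutomorphy` (Theorems/…EndoscopicReduction.lean, p97771),
definitionally. -/
theorem stubProAutomorphy_holds : StubProAutomorphy := stub_proAutomorphy

/-- The registered Stub 4 IS the landed statement `WeightTwoClassicalityRes` (p97771), definitionally. -/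
theorem weightTwoClassicalityRes_holds : WeightTwoClassicalityRes := stub_weightTwoClassicality

/-- **`ResiduallyYoshidaLifting` from the line `endoscopic-crossing-euler` (rev 7).**  Split integral frames
of `ρ₀` and `ρ` (landed Stub 2 `stub_residualYoshidaSplitting`) ⟶ ordinary pro-automorphy of `ρ` of some tame
level `S` (Stub 3′ `stub_proAutomorphy`) ⟶ weight-(2,2) classicality at the Yoshida `𝔪` (Stub 4
`stub_weightTwoClassicality`) ⟶ `Aut ρ`; the composition itself is the LANDED theorem
`residuallyYoshidaLifting_of_stubs` (Theorems/…EndoscopicReduction.lean, p97771). -/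
theorem ResiduallyYoshidaLifting_of :
    Summit.Langlands.Langlands.Theses.PhantomRMYoshida.ResiduallyYoshidaLifting :=
  residuallyYoshidaLifting_of_stubs stubProAutomorphy_holds weightTwoClassicalityRes_holds

/-- The same two stubs give the route TARGET (line B is absolute) as soon as Stub 3′ is proved in its absolute
form `ProAutOfSh` — recorded here as the implication, `phantomRMSector_of_proAutOfSh` (p97771). -/
theorem PhantomRMSector_of_proAutOfSh (h : ProAutOfSh) :
    Summit.Langlands.Langlands.Theses.PhantomRMYoshida.PhantomRMSector :=
  phantomRMSector_of_proAutOfSh h weightTwoClassicalityRes_holds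

end Summit.Langlands.Langlands.Cruxes.ResiduallyYoshidaLifting.EndoscopicCrossingEuler
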